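import Summits.Ventures.HodgeRepro2.T5CartanCoordinates
import Summits.Ventures.HodgeRepro2.T5CoshIntegral

/-!
# T5RuhlRadial — Rühl's radial variable `η = 2t` and the disc-model `L²` norm of the
lowest-weight matrix coefficient, kernel-checked

Support for `route/T5-N4-p5.md` (sub-step N4.3 = (R3)), steps (N4.3.P2′)/(N4.3.P3).  Two
corollaries of `T5CartanCoordinates` (the Poincaré measure of `𝔻 = SU(1,1)/SO(2)` in the Cartan
coordinate `t`: density `sinh t cosh t`):

* `integral_Ioo_eq_integral_eta`: in Rühl's variable `η = 2t` (his `d(η) = a_{η/2}`, R3.10) the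
  radial part of the Poincaré measure is `¼ sinh η dη` — the `½ sinh η dη` of his measure
  `½ sinh η dη (4π)⁻² dψ₁ dψ₂`, up to the normalisation constant;
* `integral_ball_one_sub_norm_sq`: Rühl's matrix coefficient of the forced vector is
  `cosh(η/2)⁻³ = cosh(t)⁻³ = (1 − ‖z‖²)^{3/2}` on `𝔻`, so its disc-model `L²` norm against the
  Poincaré measure is `∫_{𝔻} (1 − ‖z‖²)⁻² (1 − ‖z‖²)³ dA = ∫_{𝔻} (1 − ‖z‖²) dA = π/2`
  `= (∫₀^∞ sinh t cosh⁻⁵ t dt) · (∫_{−π}^{π} dθ) = ¼ · 2π` — the radial factor is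
  `T5CoshIntegral.integral_sinh_mul_cosh_rpow` at `a = 1`, `r = 4` (compare
  `T5CoshIntegral.ruhl_measure_integral_two = ½` in Rühl's normalisation: the two differ by the
  normalisation of the measure, not by the integrand).

Honest scope: normalisation constants of Haar measures are NOT matched here (Rühl's `(4π)⁻²` and
the centre `Z_j` of (N4.3.P3) are not modelled); nothing representation-theoretic is formalised.
-/

noncomputable section

namespace Summit.Ventures.HodgeRepro2.T5RuhlRadial

open MeasureTheory Set
open Summit.Ventures.HodgeRepro2.T5CartanCoordinates

variable {E : Type*} [NormedAddCommGroup E] [NormedSpace ℝ E]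

/-- Rühl's variable `η = 2t`: the radial part of the Poincaré measure is `¼ sinh η dη`. -/
theorem integral_Ioo_eq_integral_eta (G : ℝ → E) :
    ∫ r in Ioo (0 : ℝ) 1, (r / (1 - r ^ 2) ^ 2) • G r =
      ∫ η in Ioi (0 : ℝ), (Real.sinh η / 4) • G (Real.tanh (η / 2)) := by
  rw [integral_Ioo_eq_integral_sinh_two_mul]
  have key := integral_comp_mul_left_Ioi (fun η => (Real.sinh η / 4) • G (Real.tanh (η / 2))) 0
    (by norm_num : (0 : ℝ) < 2)
  rw [mul_zero] at key
  have h2 : (∫ η in Ioi (0 : ℝ), (Real.sinh η / 4) • G (Real.tanh (η / 2))) =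
      (2 : ℝ) • ∫ x in Ioi (0 : ℝ), (Real.sinh (2 * x) / 4) • G (Real.tanh (2 * x / 2)) := by
    rw [key, smul_smul]; norm_num
  rw [h2, ← integral_smul]
  refine setIntegral_congr_fun measurableSet_Ioi (fun t _ => ?_)
  rw [smul_smul, show 2 * t / 2 = t by ring]
  congr 1
  ring

/-- The pointwise form of the integrand of `integral_ball_one_sub_norm_sq` in Cartan coordinates:
`sinh t cosh t · (1 − ‖tanh t · e^{iθ}‖²)³ = sinh t · cosh t^{−5}`. -/
theorem cartan_integrand_cube (p : ℝ × ℝ) :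
    (Real.sinh p.1 * Real.cosh p.1) •
        (1 - ‖(Real.tanh p.1 : ℂ) * (Real.cos p.2 + Real.sin p.2 * Complex.I)‖ ^ 2) ^ 3 =
      Real.sinh (1 * p.1) * Real.cosh (1 * p.1) ^ (-(4 + 1 : ℝ)) * (1 : ℝ) := by
  have hnorm : ‖(Real.tanh p.1 : ℂ) * (Real.cos p.2 + Real.sin p.2 * Complex.I)‖ = |Real.tanh p.1| := by
    rw [norm_mul, Complex.ofReal_cos, Complex.ofReal_sin, Complex.norm_cos_add_sin_mul_I, mul_one,
      Complex.norm_real, Real.norm_eq_abs]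
  have hc : Real.cosh p.1 ≠ 0 := (Real.cosh_pos p.1).ne'
  have hpow : Real.cosh (1 * p.1) ^ (-(4 + 1 : ℝ)) = (Real.cosh p.1 ^ 5)⁻¹ := by
    rw [one_mul, Real.rpow_neg (Real.cosh_pos p.1).le,
      show (4 + 1 : ℝ) = ((5 : ℕ) : ℝ) by norm_num, Real.rpow_natCast]
  rw [hnorm, sq_abs, one_sub_tanh_sq, hpow, one_mul, smul_eq_mul, mul_one]
  field_simp

/-- THE DISC-MODEL `L²` NORM OF RÜHL'S LOWEST-WEIGHT MATRIX COEFFICIENT: `cosh(t)⁻³ = (1 − ‖z‖²)^{3/2}`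
on `𝔻`, so `∫_{𝔻} |cosh(t/…)⁻³|² dμ_{Poincaré} = ∫_{𝔻} (1 − ‖z‖²)⁻² (1 − ‖z‖²)³ dA = ∫_{𝔻} (1 − ‖z‖²) dA
= (∫₀^∞ sinh t cosh⁻⁵ t dt) · (∫_{−π}^{π} dθ) = ¼ · 2π = π/2` — `T5CoshIntegral.integral_sinh_mul_cosh_rpow`
at `a = 1, r = 4` on the radial factor (compare `ruhl_measure_integral_two = ½` in Rühl's normalisation). -/
theorem integral_ball_one_sub_norm_sq :
    ∫ z in Metric.ball (0 : ℂ) 1, (1 - ‖z‖ ^ 2) = Real.pi / 2 := by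
  have h1 : ∀ z ∈ Metric.ball (0 : ℂ) 1,
      (1 - ‖z‖ ^ 2) = (1 / (1 - ‖z‖ ^ 2) ^ 2) • (1 - ‖z‖ ^ 2) ^ 3 := by
    intro z hz
    have hz' : ‖z‖ < 1 := by simpa using hz
    have h : 1 - ‖z‖ ^ 2 ≠ 0 := by nlinarith [norm_nonneg z]
    rw [smul_eq_mul]
    field_simp
  rw [setIntegral_congr_fun Metric.isOpen_ball.measurableSet h1,
    integral_ball_eq_integral_cartan (fun z => (1 - ‖z‖ ^ 2) ^ 3)]
  rw [setIntegral_congr_fun (measurableSet_Ioi.prod measurableSet_Ioo)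
    (fun p _ => cartan_integrand_cube p)]
  have hprod := setIntegral_prod_mul (μ := (volume : Measure ℝ)) (ν := (volume : Measure ℝ))
    (s := Ioi (0 : ℝ)) (t := Ioo (-Real.pi) Real.pi)
    (f := fun t => Real.sinh (1 * t) * Real.cosh (1 * t) ^ (-(4 + 1 : ℝ))) (g := fun _ => (1 : ℝ))
  beta_reduce at hprod
  rw [Measure.volume_eq_prod, hprod,
    T5CoshIntegral.integral_sinh_mul_cosh_rpow 1 4 one_pos (by norm_num), setIntegral_const,
    measureReal_def, Real.volume_Ioo,
    ENNReal.toReal_ofReal (by linarith [Real.pi_pos] : (0 : ℝ) ≤ Real.pi - -Real.pi), smul_eq_mul]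
  ring

end Summit.Ventures.HodgeRepro2.T5RuhlRadial

end
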